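import Summits.ABC.ABC.Theorems.PrimePowerRadical.Negative.Orders
import Summits.ABC.ABC.Theorems.PrimePowerRadical.Negative.Powerful
import Summits.ABC.ABC.Theorems.IneffectiveSubspacePrimePowerRadicalStubWieferichSparseOfWdc

/-!
# What the open stub of line `Sketch` carries: the wall certificate for `PrimePowerRadical` (stmt-ABC-1648)

Line `Sketch` (card `adelic-brjuno-summability`) for the crux `Summit.ABC.ABC.Theses.IneffectiveSubspace.PrimePowerRadical`.
Notation: `W_p(q) := wieferichLevel q p`, `ord_p(q) := ordMod q p`, atom `c_p(q) := (W_p(q) − 1)·log p / ord_p(q)`, and the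
Wieferich–Brjuno summability hypothesis at the prime base `q` ("WDC q", `T_q < ∞`):
`Summable (fun p : Nat.Primes => c_p(q))`.

The line's composition (lead skeleton `Cruxes/PrimePowerRadical/Lines/Sketch.lean`, `PrimePowerRadical_of`) concludes the crux BY
NAME from this hypothesis at every prime base (landed lever `stub_wieferichSparse_of_wdc` + `Negative.PPRAt_iff_wieferichSparse`).
The hypothesis is NOT a theorem — it is the one open stub `stub_wdc` of the line — and
* `stub_wall_of_wdc` — THE WALL CERTIFICATE (registered stub of the line) — shows it is crux-sized: at a prime base `q`, `T_q < ∞` implies the crux at `q`,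
  the infinitude of NON-Wieferich primes to base `q` (Silverman 1988's conclusion, open for every `q ≥ 2`, known only under abc),
  for every `E ≥ 1` the infinitude of primes of Wieferich level `≤ E` (no rung known for any base), and conjecture (E_q) "only
  finitely many `q^k − 1` are powerful" (Ribenboim 1989 Ch. 5 §III, open) — all from landed `Negative.*` lemmas.

So the line reduces the crux to ONE `k`-free statement about the order/level profile of the Wieferich primes of `q`, sandwiched
by the landed necessary direction `stub_atom_tendsto_zero` (crux(q) ⟹ c_p(q) → 0): `c₀ ⟸ crux(q) ⟸ ℓ¹`, and calibrated by
`stub_romanoff_log` (E[T_q] < ∞ in the 1/p model) and the metric mean bound `stub_metric_wdc_of`. Sources: card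
`adelic-brjuno-summability`; Silverman, JNT 30 (1988); Ribenboim 1989 Ch. 5 §III. NOT here: any claim that the hypothesis holds,
and the conditional closure itself (it stays in the lead skeleton until the hypothesis is a registered obligation).
-/

noncomputable section

-- `Summit.<Summit>.<Problem>` is the mandated summit-side namespace (CONVENTIONS §2); for the
-- single-conjunct summit `ABC` the two coincide, so the duplicate `ABC.ABC` is deliberate.
set_option linter.dupNamespace false

namespace Summit.ABC.ABC.Theorems.PrimePowerRadical.Brjuno

open Literature.NumberTheory.DiophantineGeometry UniqueFactorizationMonoid
open Summit.ABC.ABC.Theses.IneffectiveSubspace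
open Summit.ABC.ABC.Theorems.PrimePowerRadical.Negative
open scoped BigOperators

/-- **The wall certificate: the line's open stub is crux-sized.** At a prime base `q`, Wieferich–Brjuno summability
`Σ_p (W_p(q) − 1)·log p / ord_p(q) < ∞` implies: (i) the crux at `q` for every `ε`; (ii) infinitely many NON-Wieferich primes to
base `q`; (iii) for every `E ≥ 1`, infinitely many primes of Wieferich level `≤ E`; (iv) only finitely many powerful `q^k − 1`.
Each of (i)–(iv) is open for every `q ≥ 2` (Silverman 1988; Ribenboim 1989 Ch. 5 §III (2) and conjecture (E_q)). -/
theorem stub_wall_of_wdc {q : ℕ} (hq : q.Prime)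
    (h : Summable (fun p : Nat.Primes =>
      ((wieferichLevel q p - 1 : ℕ) : ℝ) * Real.log p / (ordMod q p : ℝ))) :
    (∀ ε : ℝ, 0 < ε → ∃ C : ℝ, 0 < C ∧ ∀ k : ℕ, 1 ≤ k →
        ((q ^ k : ℕ) : ℝ) < C * ((rad 1 (q ^ k - 1) (q ^ k) : ℕ) : ℝ) ^ (1 + ε)) ∧
      {p : ℕ | p.Prime ∧ ¬ IsWieferich q p}.Infinite ∧
      (∀ E : ℕ, 1 ≤ E → {p : ℕ | p.Prime ∧ wieferichLevel q p ≤ E}.Infinite) ∧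
      {k : ℕ | 1 ≤ k ∧ ∀ p ∈ (q ^ k - 1).primeFactors, p ^ 2 ∣ q ^ k - 1}.Finite := by
  have hsparse := stub_wieferichSparse_of_wdc hq h
  have hcrux := (PPRAt_iff_wieferichSparse hq).mpr hsparse
  refine ⟨hcrux, infinite_nonWieferich_of_wieferichSparse hq hsparse, fun E hE => ?_,
    finite_powerful_of_PPRAt_half hq (hcrux (1 / 2) (by norm_num))⟩
  have h12 : (1 / 2 : ℝ) < E := by
    have : (1 : ℝ) ≤ E := by exact_mod_cast hE
    linarith
  exact infinite_level_le_of_PPRAt hq (by norm_num) E h12 (hcrux (1 / 2) (by norm_num))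

end Summit.ABC.ABC.Theorems.PrimePowerRadical.Brjuno

end
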